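import Summits.HubbardSuperconductivity.HubbardSuperconductivity.Theorems.AnisotropyChordTransferFibre3GeomGMin
import Mathlib.Analysis.SpecialFunctions.Exponential
import Mathlib.Analysis.SpecialFunctions.ExpDeriv
import Mathlib.Analysis.Calculus.Deriv.MeanValue

/-!
# Route `AnisotropyChord` / H0 rotor rung: PartN35 (Level-2 toolkit) — LEMMA G-MIN, heat-kernel form `HeatKernelGMin` PROVED

PartN35 = `…Fibre3Level2Toolkit` (theory seat `hubbard-h0-rotor-theory-1`, memo 21 §312; port by `hubbard-h0-rotor-p2`):
**`heatKernelGMin_holds : HeatKernelGMin L`** — for `0 < λ < 2ε₁`, every `t₀ > 0` and every site `r`,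
`−G_λ(r) ≤ (e^{λt₀} − 1)/(λV) + (1/V) Σ_{k≠0} g(k) e^{−t₀/g(k)}`.

Proof (no integrals):
* HEAT-KERNEL POSITIVITY (`heat_nonneg`): `Σ_k e^{(4−2ε(k))t} Re e^{ik·r} = Σ_n (tⁿ/n!)·W_n(r) ≥ 0` for `t ≥ 0`, where
  `W_n(r) := Σ_k (4 − 2ε(k))ⁿ Re e^{ik·r} ≥ 0` counts `n`-step walks (`W_succ`: `W_{n+1}(r) = Σ_e W_n(r+e)`); the exponential
  is expanded with `NormedSpace.exp_eq_tsum_div` and the finite `k`-sum exchanged with the series (`Summable.tsum_finsetSum`);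
* hence for `t ≥ 0`: `Σ_{k≠0} (−Re e^{ik·r}) e^{−(2ε(k)−λ)t} ≤ e^{λt}` (`deriv_bound`: the `k = 0` mode is `e^{4t}`);
* the function `F(t) = (e^{λt} − 1)/λ − Σ_{k≠0} (−Re e^{ik·r}) g(k)(1 − e^{−(2ε(k)−λ)t})` has `F(0) = 0` and `F' ≥ 0` on `t > 0`
  (`monotoneOn_of_deriv_nonneg`), so `F(t₀) ≥ 0`; finally `−Re e^{ik·r} ≤ 1` bounds the remainder `Σ_{k≠0} (−Re)·g·e^{−t₀/g}`.

Nothing here proves superconductivity in the Hubbard model; these are helper lemmas of ONE conditional reduction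
(rung stmt-HubbardSuperconductivity-19089).  Prover seat `hubbard-h0-rotor-p3` g0; `--supports stmt-HubbardSuperconductivity-19089`.
-/

set_option linter.dupNamespace false
set_option autoImplicit false

noncomputable section

open scoped BigOperators Nat
open Complex

namespace Summit.HubbardSuperconductivity.HubbardSuperconductivity.Theorems.AnisotropyChord.Transfer.Fibre3

variable (L : ℕ) [NeZero L]

/-! ## Walk counting: `W_n(r) = Σ_k (4 − 2ε(k))ⁿ Re e^{ik·r} ≥ 0` -/

/-- `(4 − 2ε(k)) Re φ_k(r) = Σ_e Re φ_k(r + e)` (the symbol of the adjacency operator). [folklore] -/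
theorem s_mul_phase_re (k r : Tor L) :
    (4 - 2 * epsT L k) * (phase L k r).re
      = (phase L k (r + ex L)).re + (phase L k (r + -ex L)).re + (phase L k (r + ey L)).re
        + (phase L k (r + -ey L)).re := by
  have h := b_mul_phase_re L k r
  linarith

/-- the walk recursion `W_{n+1}(r) = Σ_e W_n(r+e)`. [folklore] -/
theorem W_succ (n : ℕ) (r : Tor L) :
    ∑ k : Tor L, (4 - 2 * epsT L k) ^ (n + 1) * (phase L k r).re
      = ∑ k : Tor L, (4 - 2 * epsT L k) ^ n * (phase L k (r + ex L)).re
        + ∑ k : Tor L, (4 - 2 * epsT L k) ^ n * (phase L k (r + -ex L)).re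
        + ∑ k : Tor L, (4 - 2 * epsT L k) ^ n * (phase L k (r + ey L)).re
        + ∑ k : Tor L, (4 - 2 * epsT L k) ^ n * (phase L k (r + -ey L)).re := by
  have hpt : ∀ k : Tor L, (4 - 2 * epsT L k) ^ (n + 1) * (phase L k r).re
      = (4 - 2 * epsT L k) ^ n * (phase L k (r + ex L)).re
        + (4 - 2 * epsT L k) ^ n * (phase L k (r + -ex L)).re
        + (4 - 2 * epsT L k) ^ n * (phase L k (r + ey L)).re
        + (4 - 2 * epsT L k) ^ n * (phase L k (r + -ey L)).re := by
    intro k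
    rw [pow_succ, mul_assoc, s_mul_phase_re]
    ring
  rw [Finset.sum_congr rfl fun k _ => hpt k, Finset.sum_add_distrib, Finset.sum_add_distrib, Finset.sum_add_distrib]

/-- **`W_n(r) ≥ 0`.** [folklore] -/
theorem W_nonneg (n : ℕ) : ∀ r : Tor L, 0 ≤ ∑ k : Tor L, (4 - 2 * epsT L k) ^ n * (phase L k r).re := by
  induction n with
  | zero =>
    intro r
    simp only [pow_zero, one_mul]
    rw [← Complex.re_sum, sum_phase_left]
    split_ifs
    · rw [show ((L : ℂ) ^ 2) = (((L : ℝ) ^ 2 : ℝ) : ℂ) by push_cast; ring, Complex.ofReal_re]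
      positivity
    · simp
  | succ n ih =>
    intro r
    rw [W_succ]
    have h1 := ih (r + ex L)
    have h2 := ih (r + -ex L)
    have h3 := ih (r + ey L)
    have h4 := ih (r + -ey L)
    positivity

/-! ## Heat-kernel positivity -/

/-- the real exponential as its power series. [folklore] -/
theorem real_exp_eq_tsum (x : ℝ) : Real.exp x = ∑' n : ℕ, x ^ n / (n ! : ℝ) := by
  rw [Real.exp_eq_exp_ℝ, NormedSpace.exp_eq_tsum_div]

/-- **HEAT-KERNEL POSITIVITY:** `Σ_k e^{(4 − 2ε(k))t} Re e^{ik·r} ≥ 0` for `t ≥ 0`. [folklore] -/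
theorem heat_nonneg {t : ℝ} (ht : 0 ≤ t) (r : Tor L) :
    0 ≤ ∑ k : Tor L, Real.exp ((4 - 2 * epsT L k) * t) * (phase L k r).re := by
  have hs : ∀ k : Tor L,
      Summable (fun n : ℕ => ((4 - 2 * epsT L k) * t) ^ n / (n ! : ℝ) * (phase L k r).re) :=
    fun k => (Real.summable_pow_div_factorial _).mul_right _
  have e : ∀ k : Tor L, Real.exp ((4 - 2 * epsT L k) * t) * (phase L k r).re
      = ∑' n : ℕ, ((4 - 2 * epsT L k) * t) ^ n / (n ! : ℝ) * (phase L k r).re := by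
    intro k
    rw [real_exp_eq_tsum, ← Summable.tsum_mul_right _ (Real.summable_pow_div_factorial _)]
  rw [Finset.sum_congr rfl fun k _ => e k, ← Summable.tsum_finsetSum (fun k _ => hs k)]
  apply tsum_nonneg
  intro n
  have hn : ∑ k : Tor L, ((4 - 2 * epsT L k) * t) ^ n / (n ! : ℝ) * (phase L k r).re
      = t ^ n / (n ! : ℝ) * ∑ k : Tor L, (4 - 2 * epsT L k) ^ n * (phase L k r).re := by
    rw [Finset.mul_sum]
    refine Finset.sum_congr rfl fun k _ => ?_
    rw [mul_pow]
    ring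
  rw [hn]
  exact mul_nonneg (div_nonneg (pow_nonneg ht _) (Nat.cast_nonneg _)) (W_nonneg L n r)

/-- **the derivative bound:** for `t ≥ 0`, `Σ_{k≠0} (−Re e^{ik·r}) e^{−(2ε(k)−λ)t} ≤ e^{λt}`. [folklore] -/
theorem deriv_bound (lam2 : ℝ) {t : ℝ} (ht : 0 ≤ t) (r : Tor L) :
    ∑ k ∈ (Finset.univ : Finset (Tor L)).erase 0, -(phase L k r).re * Real.exp (-(2 * epsT L k - lam2) * t)
      ≤ Real.exp (lam2 * t) := by
  classical
  have hpos := heat_nonneg L ht r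
  rw [← Finset.add_sum_erase _ _ (Finset.mem_univ (0 : Tor L)), epsT_zero, phase_zero_left, Complex.one_re,
    mul_one] at hpos
  have e : ∀ k : Tor L, -(phase L k r).re * Real.exp (-(2 * epsT L k - lam2) * t)
      = -(Real.exp ((4 - 2 * epsT L k) * t) * (phase L k r).re) * Real.exp ((lam2 - 4) * t) := by
    intro k
    rw [show -(2 * epsT L k - lam2) * t = (4 - 2 * epsT L k) * t + (lam2 - 4) * t by ring, Real.exp_add]
    ring
  rw [Finset.sum_congr rfl fun k _ => e k, ← Finset.sum_mul, Finset.sum_neg_distrib]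
  have h4 : Real.exp (lam2 * t) = Real.exp ((4 - 2 * 0) * t) * Real.exp ((lam2 - 4) * t) := by
    rw [← Real.exp_add]; congr 1; ring
  rw [h4]
  have hE : 0 < Real.exp ((lam2 - 4) * t) := Real.exp_pos _
  nlinarith [mul_nonneg hpos hE.le]

/-! ## `HeatKernelGMin` -/

/-- ★ **`HeatKernelGMin L` holds.** [folklore] -/
theorem heatKernelGMin_holds : HeatKernelGMin L := by
  classical
  intro lam2 hl0 hl2 t0 ht0 r
  -- `L ≥ 2` (for `L = 1`, `ε₁ = 0` contradicts `0 < λ < 2ε₁`)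
  have hL2 : 2 ≤ L := by
    by_contra h
    have hL1 : (L : ℝ) = 1 := by have := NeZero.ne L; exact_mod_cast (show L = 1 by omega)
    have : eps1 L = 0 := by unfold eps1; rw [hL1, div_one, Real.cos_two_pi]; ring
    linarith
  have hVpos : (0 : ℝ) < (L : ℝ) ^ 2 := by
    have : (0 : ℝ) < L := by exact_mod_cast (show 0 < L by omega)
    positivity
  -- the resolvent off the origin
  have ha : ∀ k : Tor L, k ≠ 0 → 0 < 2 * epsT L k - lam2 := by
    intro k hk; have := eps1_le_epsT L hL2 hk; linarith
  have hg : ∀ k : Tor L, k ≠ 0 → gres L lam2 k = 1 / (2 * epsT L k - lam2) := by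
    intro k hk; unfold gres; rw [if_neg hk]
  have hgpos : ∀ k : Tor L, k ≠ 0 → 0 < gres L lam2 k := by
    intro k hk; rw [hg k hk]; exact one_div_pos.mpr (ha k hk)
  -- the comparison function `F` and its derivative
  set F : ℝ → ℝ := fun t => (Real.exp (lam2 * t) - 1) / lam2
      - ∑ k ∈ (Finset.univ : Finset (Tor L)).erase 0,
          -(phase L k r).re * gres L lam2 k * (1 - Real.exp (-(2 * epsT L k - lam2) * t)) with hF
  have hlin : ∀ a t : ℝ, HasDerivAt (fun s : ℝ => a * s) a t := fun a t => by
    simpa using (hasDerivAt_id t).const_mul a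
  have hderiv : ∀ t : ℝ, HasDerivAt F (Real.exp (lam2 * t)
      - ∑ k ∈ (Finset.univ : Finset (Tor L)).erase 0,
          -(phase L k r).re * Real.exp (-(2 * epsT L k - lam2) * t)) t := by
    intro t
    have hl0' : lam2 ≠ 0 := hl0.ne'
    have h1 : HasDerivAt (fun s : ℝ => (Real.exp (lam2 * s) - 1) / lam2) (Real.exp (lam2 * t)) t := by
      have h := (((hlin lam2 t).exp).sub_const 1).div_const lam2
      refine h.congr_deriv ?_
      field_simp
    have h2 : ∀ k ∈ (Finset.univ : Finset (Tor L)).erase 0,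
        HasDerivAt (fun s : ℝ => -(phase L k r).re * gres L lam2 k * (1 - Real.exp (-(2 * epsT L k - lam2) * s)))
          (-(phase L k r).re * Real.exp (-(2 * epsT L k - lam2) * t)) t := by
      intro k hk
      have hk0 : k ≠ 0 := Finset.ne_of_mem_erase hk
      have h := (((hlin (-(2 * epsT L k - lam2)) t).exp).const_sub 1).const_mul
        (-(phase L k r).re * gres L lam2 k)
      refine h.congr_deriv ?_
      rw [hg k hk0]
      have hne : 2 * epsT L k - lam2 ≠ 0 := (ha k hk0).ne'
      field_simp
    rw [hF]
    exact h1.sub (HasDerivAt.fun_sum h2)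
  -- `F` is monotone on `[0, ∞)`
  have hmono : MonotoneOn F (Set.Ici 0) := by
    apply monotoneOn_of_deriv_nonneg (convex_Ici 0)
    · exact fun t _ => (hderiv t).continuousAt.continuousWithinAt
    · exact fun t _ => (hderiv t).differentiableAt.differentiableWithinAt
    · intro t ht
      rw [interior_Ici] at ht
      rw [(hderiv t).deriv]
      have := deriv_bound L lam2 (le_of_lt ht) r
      linarith
  have hF0 : F 0 = 0 := by
    simp only [hF, mul_zero, Real.exp_zero, sub_self, zero_div, Finset.sum_const_zero]
  have hFt : 0 ≤ F t0 := by
    have := hmono (Set.mem_Ici.mpr le_rfl) (Set.mem_Ici.mpr ht0.le) ht0.le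
    rwa [hF0] at this
  have hmain : ∑ k ∈ (Finset.univ : Finset (Tor L)).erase 0,
      -(phase L k r).re * gres L lam2 k * (1 - Real.exp (-(2 * epsT L k - lam2) * t0))
        ≤ (Real.exp (lam2 * t0) - 1) / lam2 := by
    have h : F t0 = (Real.exp (lam2 * t0) - 1) / lam2
        - ∑ k ∈ (Finset.univ : Finset (Tor L)).erase 0,
            -(phase L k r).re * gres L lam2 k * (1 - Real.exp (-(2 * epsT L k - lam2) * t0)) := by
      simp only [hF]
    linarith
  -- the remainder: `−Re φ ≤ 1`
  have hrest : ∑ k ∈ (Finset.univ : Finset (Tor L)).erase 0,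
      -(phase L k r).re * gres L lam2 k * Real.exp (-(2 * epsT L k - lam2) * t0)
        ≤ ∑ k ∈ (Finset.univ : Finset (Tor L)).erase 0,
            gres L lam2 k * Real.exp (-(t0 / gres L lam2 k)) := by
    refine Finset.sum_le_sum fun k hk => ?_
    have hk0 : k ≠ 0 := Finset.ne_of_mem_erase hk
    have harg : -(t0 / gres L lam2 k) = -(2 * epsT L k - lam2) * t0 := by
      rw [hg k hk0]; field_simp
    rw [harg]
    have hw : 0 ≤ gres L lam2 k * Real.exp (-(2 * epsT L k - lam2) * t0) :=
      mul_nonneg (hgpos k hk0).le (Real.exp_pos _).le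
    have hre := neg_one_le_phase_re L k r
    nlinarith
  -- assemble and divide by `V`
  have hsum : -(∑ k : Tor L, gres L lam2 k * (phase L k r).re)
      = ∑ k ∈ (Finset.univ : Finset (Tor L)).erase 0,
          -(phase L k r).re * gres L lam2 k * (1 - Real.exp (-(2 * epsT L k - lam2) * t0))
        + ∑ k ∈ (Finset.univ : Finset (Tor L)).erase 0,
          -(phase L k r).re * gres L lam2 k * Real.exp (-(2 * epsT L k - lam2) * t0) := by
    rw [← Finset.add_sum_erase _ _ (Finset.mem_univ (0 : Tor L))]
    have hg0 : gres L lam2 0 = 0 := by unfold gres; rw [if_pos rfl]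
    rw [hg0, zero_mul, zero_add, ← Finset.sum_add_distrib, ← Finset.sum_neg_distrib]
    refine Finset.sum_congr rfl fun k _ => ?_
    ring
  have key : -(∑ k : Tor L, gres L lam2 k * (phase L k r).re)
      ≤ (Real.exp (lam2 * t0) - 1) / lam2
        + ∑ k ∈ (Finset.univ : Finset (Tor L)).erase 0, gres L lam2 k * Real.exp (-(t0 / gres L lam2 k)) := by
    rw [hsum]; linarith
  have hlhs : -Gres L lam2 r = -(∑ k : Tor L, gres L lam2 k * (phase L k r).re) / (L : ℝ) ^ 2 := by
    unfold Gres; rw [neg_div]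
  have hrhs : (Real.exp (lam2 * t0) - 1) / (lam2 * (L : ℝ) ^ 2)
      + (∑ k ∈ (Finset.univ : Finset (Tor L)).erase 0, gres L lam2 k * Real.exp (-(t0 / gres L lam2 k)))
          / (L : ℝ) ^ 2
      = ((Real.exp (lam2 * t0) - 1) / lam2
          + ∑ k ∈ (Finset.univ : Finset (Tor L)).erase 0, gres L lam2 k * Real.exp (-(t0 / gres L lam2 k)))
        / (L : ℝ) ^ 2 := by
    rw [add_div, div_div]
  rw [hlhs, hrhs]
  exact div_le_div_of_nonneg_right key hVpos.le

end Summit.HubbardSuperconductivity.HubbardSuperconductivity.Theorems.AnisotropyChord.Transfer.Fibre3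

end
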